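import Mathlib
import Literature.Computability.Complexity.RangeAvoidance
import Literature.Computability.Complexity.SignDegreeXor
import Summits.PneNP.PneNP.Theorems.PstarPDT
import Summits.PneNP.PneNP.Theorems.PstarFibrePolys
import Summits.PneNP.PneNP.Theorems.PstarSALevel
import Summits.PneNP.PneNP.Theorems.PstarSAClosure
import Summits.PneNP.PneNP.Theorems.PstarTyped
import Summits.PneNP.PneNP.Theorems.PstarGapLemma
import Summits.PneNP.PneNP.Theorems.PstarGapLinearised
import Summits.PneNP.PneNP.Theorems.PstarGapPeeling
import Summits.PneNP.PneNP.Theorems.PstarGapAdversary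
import Summits.PneNP.PneNP.Theorems.PstarNoDeadCentre
import Summits.PneNP.PneNP.Theorems.PstarCentreFree
import Summits.PneNP.PneNP.Theorems.PstarGapOneAndRepair
import Summits.PneNP.PneNP.Theorems.PstarGapOneAnd
import Summits.PneNP.PneNP.Theorems.PstarGraphQuadGapOne
import Summits.PneNP.PneNP.Theorems.PstarGapOneAll
import Summits.PneNP.PneNP.Theorems.PstarGConstraint
import Summits.PneNP.PneNP.Theorems.PstarGSatChord
import Summits.PneNP.PneNP.Theorems.PstarGSatStructure

/-!
# The reader-graph induction: the no-chord contradiction (d) (ROUND-24 item T24.17′, steps)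

FRONTIER range-avoidance ladder, rung F-N3, ROUND 24 (cell `pnp-ideate`; restricted-model proof complexity — nothing here bears on
`P` versus `NP`).  Memo ROUND-24-PRESEED §13 R10(p)(d); referee AUDIT-r10p-gsat-g43 (P3).

**`no_chord_false`.**  In the inductive step of `GSat` (unsat assumption), suppose `J ≠ ∅` has NO chord (no output with both AND
slots `J`-private), NO reader (no output with both XOR slots `J`-private) and every `J`-private XOR slot lies in `C` (the outcomes of
steps (c), (b), (a)).  `(r,3/2)`-expansion and the peeling pigeonhole give an output `f` owning two private variables, necessarily one
XOR slot `t ∈ C` and one AND slot `p` (partner `d`, not private).  For every solution `z` of `J`: if `z_d = 0`, toggling `p` stays a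
solution, so `alpha z p = 0`; if `z_d = 1`, toggling `t` and `p` stays a solution and moves `gval` by `1 + alpha z p`, so
`alpha z p = 1`.  Hence the AND-typed parity `⊕_{N_G(p) ∪ {d}} z = [p ∈ C]` holds on all of `Sol(J)`; its negation is an infeasible
single AND-parity, a minimal infeasible sub-family is extracted (`PstarGapAdversary.exists_minInfeasible_subset`) and
`PstarGapOneAnd.gapOneAnd` (T24.16) forces it empty — but the empty family is feasible.  Contradiction.
-/

set_option linter.dupNamespace false -- `Summit.PneNP.PneNP.…`: summit = sub-problem name (D-0017 single-conjunct layout)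

open Finset Literature.Computability.Complexity
open Summit.PneNP.PneNP.Theorems.PstarPDT (parity)
open Summit.PneNP.PneNP.Theorems.PstarFibrePolys (bit bit_injective)
open Summit.PneNP.PneNP.Theorems.PstarTyped (Typed)
open Summit.PneNP.PneNP.Theorems.PstarSALevel (varSet bdry BoundaryExpanding SimpleOverlap)
open Summit.PneNP.PneNP.Theorems.PstarSAClosure (exists_two_private)
open Summit.PneNP.PneNP.Theorems.PstarGapLemma (Sat Feasible MinInfeasible)
open Summit.PneNP.PneNP.Theorems.PstarGapLinearised (andPair)
open Summit.PneNP.PneNP.Theorems.PstarGapPeeling (not_mem_varSet_of_private eval_update_of_not_mem eval_pure eval_update_xor_slot)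
open Summit.PneNP.PneNP.Theorems.PstarGapAdversary (exists_minInfeasible_subset)
open Summit.PneNP.PneNP.Theorems.PstarNoDeadCentre (IsAndVar GapOneAnd)
open Summit.PneNP.PneNP.Theorems.PstarCentreFree (vars_mem_varSet)
open Summit.PneNP.PneNP.Theorems.PstarGapOneAndRepair (eval_update_and_slot exists_slot_of_mem_varSet)
open Summit.PneNP.PneNP.Theorems.PstarGapOneAnd (gapOneAnd)
open Summit.PneNP.PneNP.Theorems.PstarGraphQuadGapOne (bit_parity)
open Summit.PneNP.PneNP.Theorems.PstarGapOneAll (gval)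
open Summit.PneNP.PneNP.Theorems.PstarGConstraint
open Summit.PneNP.PneNP.Theorems.PstarGSatChord
open Summit.PneNP.PneNP.Theorems.PstarGSatStructure

namespace Summit.PneNP.PneNP.Theorems.PstarGSatNoChord

variable {n m : ℕ}

/-- In `𝔽₂`, `x + x = 0`. -/
private theorem zmod2_add_self (x : ZMod 2) : x + x = 0 := by
  revert x; decide

/-- `bit (¬a) + bit a = 1`. -/
private theorem bit_not_add (a : Bool) : bit (!a) + bit a = 1 := by
  cases a <;> decide

/-- Two Booleans avoiding the same value are equal. -/
private theorem bool_eq_of_ne {x x' b : Bool} (hx : x ≠ b) (hx' : x' ≠ b) : x = x' := by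
  revert hx hx'; cases x <;> cases x' <;> cases b <;> decide

/-- On a typed instance `alpha` ignores XOR-slot variables. -/
theorem alpha_update_xor (I : LocalMap 4 n m) (hT : Typed I) (C : Finset (Fin n)) (G : Finset (Fin m)) (z : Fin n → Bool)
    {j : Fin m} {s : Fin 4} (hs : s.val < 2) (bv : Bool) (p : Fin n) :
    alpha I C G (Function.update z (I.vars j s) bv) p = alpha I C G z p := by
  classical
  unfold alpha
  congr 1
  refine sum_congr rfl fun g _ => ?_
  rw [Function.update_of_ne]
  unfold other
  split_ifs
  · exact fun h => hT j g s 3 hs (by decide) h.symm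
  · exact fun h => hT j g s 2 hs (by decide) h.symm

section NoChord

variable (I : LocalMap 4 n m) (hI : I.IsPure xorAndPred) (hT : Typed I) {r : ℕ} (hB : BoundaryExpanding r I) (hS : SimpleOverlap I)
  (y : Fin m → Bool) (J G : Finset (Fin m)) (C : Finset (Fin n)) (b : Bool) (hJr : J.card ≤ r) (hJG : Disjoint J G)
  (hunsat : ∀ z : Fin n → Bool, (∀ j ∈ J, I.eval z j = y j) → gval I C G z ≠ b)

include hI hT hB hS hJr hJG hunsat

/-- **(d) No chord, no reader, private XOR slots in `C` — impossible for `J ≠ ∅`.** -/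
theorem no_chord_false (hJne : J.Nonempty)
    (hxorC : ∀ g ∈ J, ∀ s : Fin 4, s.val < 2 → I.vars g s ∈ bdry I J → I.vars g s ∈ C)
    (hnoreader : ∀ g ∈ J, ¬ (I.vars g 0 ∈ bdry I J ∧ I.vars g 1 ∈ bdry I J))
    (hnochord : ∀ g ∈ J, ¬ (I.vars g 2 ∈ bdry I J ∧ I.vars g 3 ∈ bdry I J)) : False := by
  classical
  obtain ⟨hnd, hdist⟩ := andPairs_simple I hI hS G
  -- an output with two private variables
  have hlt : J.card < (bdry I J \ ∅).card := by
    rw [sdiff_empty]; have := hB J hJr; have := card_pos.2 hJne; omega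
  obtain ⟨f, hf, hP⟩ := exists_two_private I J ∅ hlt
  rw [sdiff_empty] at hP
  have hPslot : ∀ v ∈ (bdry I J).filter (fun v => v ∈ varSet I f), ∃ s : Fin 4, I.vars f s = v ∧ I.vars f s ∈ bdry I J := by
    intro v hv
    obtain ⟨hvb, hvf⟩ := mem_filter.1 hv
    obtain ⟨s, hs⟩ := exists_slot_of_mem_varSet I hvf
    exact ⟨s, hs, hs ▸ hvb⟩
  -- one private XOR slot and one private AND slot
  have hX : ∃ s : Fin 4, s.val < 2 ∧ I.vars f s ∈ bdry I J := by
    by_contra hno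
    push Not at hno
    -- all private slots are AND slots, at most one
    have key : ∀ v ∈ (bdry I J).filter (fun v => v ∈ varSet I f), ∃ s : Fin 4, 2 ≤ s.val ∧ I.vars f s = v ∧ I.vars f s ∈ bdry I J := by
      intro v hv
      obtain ⟨s, hs, hsb⟩ := hPslot v hv
      by_cases h2 : 2 ≤ s.val
      · exact ⟨s, h2, hs, hsb⟩
      · exact absurd hsb (hno s (by omega))
    have hsub : (bdry I J).filter (fun v => v ∈ varSet I f) ⊆ {I.vars f 2} ∨
        (bdry I J).filter (fun v => v ∈ varSet I f) ⊆ {I.vars f 3} := by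
      by_cases h2b : I.vars f 2 ∈ bdry I J
      · left
        intro v hv
        obtain ⟨s, hs2, hsv, hsb⟩ := key v hv
        rw [mem_singleton, ← hsv]
        have : s = 2 ∨ s = 3 := by fin_cases s <;> simp at hs2 ⊢
        rcases this with rfl | rfl
        · rfl
        · exact absurd ⟨h2b, hsb⟩ (hnochord f hf)
      · right
        intro v hv
        obtain ⟨s, hs2, hsv, hsb⟩ := key v hv
        rw [mem_singleton, ← hsv]
        have : s = 2 ∨ s = 3 := by fin_cases s <;> simp at hs2 ⊢
        rcases this with rfl | rfl
        · exact absurd hsb h2b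
        · rfl
    rcases hsub with h | h <;>
    · have := card_le_card h; rw [card_singleton] at this; omega
  have hA : ∃ s : Fin 4, 2 ≤ s.val ∧ I.vars f s ∈ bdry I J := by
    by_contra hno
    push Not at hno
    have key : ∀ v ∈ (bdry I J).filter (fun v => v ∈ varSet I f), ∃ s : Fin 4, s.val < 2 ∧ I.vars f s = v ∧ I.vars f s ∈ bdry I J := by
      intro v hv
      obtain ⟨s, hs, hsb⟩ := hPslot v hv
      by_cases h2 : 2 ≤ s.val
      · exact absurd hsb (hno s h2)
      · exact ⟨s, by omega, hs, hsb⟩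
    have hsub : (bdry I J).filter (fun v => v ∈ varSet I f) ⊆ {I.vars f 0} ∨
        (bdry I J).filter (fun v => v ∈ varSet I f) ⊆ {I.vars f 1} := by
      by_cases h0b : I.vars f 0 ∈ bdry I J
      · left
        intro v hv
        obtain ⟨s, hs2, hsv, hsb⟩ := key v hv
        rw [mem_singleton, ← hsv]
        have : s = 0 ∨ s = 1 := by fin_cases s <;> simp at hs2 ⊢
        rcases this with rfl | rfl
        · rfl
        · exact absurd ⟨h0b, hsb⟩ (hnoreader f hf)
      · right
        intro v hv
        obtain ⟨s, hs2, hsv, hsb⟩ := key v hv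
        rw [mem_singleton, ← hsv]
        have : s = 0 ∨ s = 1 := by fin_cases s <;> simp at hs2 ⊢
        rcases this with rfl | rfl
        · exact absurd hsb h0b
        · rfl
    rcases hsub with h | h <;>
    · have := card_le_card h; rw [card_singleton] at this; omega
  obtain ⟨sx, hsx, hxb⟩ := hX
  obtain ⟨sa, hsa, hab⟩ := hA
  obtain ⟨sd, hsd, had⟩ : ∃ sd : Fin 4, 2 ≤ sd.val ∧ sa ≠ sd := by
    have : sa = 2 ∨ sa = 3 := by fin_cases sa <;> simp at hsa ⊢
    rcases this with rfl | rfl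
    · exact ⟨3, by decide, by decide⟩
    · exact ⟨2, by decide, by decide⟩
  -- names: `t` private XOR slot (∈ C), `p` private AND slot, `d` its partner
  have htC : I.vars f sx ∈ C := hxorC f hf sx hsx hxb
  have hpt : I.vars f sa ≠ I.vars f sx := fun h => hT f f sx sa hsx hsa h.symm
  have hdt : I.vars f sd ≠ I.vars f sx := fun h => hT f f sx sd hsx hsd h.symm
  have hpd : I.vars f sa ≠ I.vars f sd := fun h => had (hI.2 f h)
  have htpriv : ∀ j ∈ J, j ≠ f → I.vars f sx ∉ varSet I j := fun j hj hne =>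
    not_mem_varSet_of_private I hf hj hne hxb (vars_mem_varSet I f sx)
  have hppriv : ∀ j ∈ J, j ≠ f → I.vars f sa ∉ varSet I j := fun j hj hne =>
    not_mem_varSet_of_private I hf hj hne hab (vars_mem_varSet I f sa)
  -- the product of `f` with `d = false` does not see `p`
  have hprod0 : ∀ z : Fin n → Bool, z (I.vars f sd) = false → ∀ a : Bool,
      I.eval (Function.update z (I.vars f sa) a) f = I.eval z f := by
    intro z hd a
    have hinj := hI.2 f
    have hne : ∀ s t : Fin 4, s ≠ t → I.vars f s ≠ I.vars f t := fun s t hst h => hst (hinj h)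
    rw [eval_pure I hI, eval_pure I hI]
    have hsx0 : I.vars f 0 ≠ I.vars f sa := fun h => hT f f 0 sa (by decide) hsa h
    have hsx1 : I.vars f 1 ≠ I.vars f sa := fun h => hT f f 1 sa (by decide) hsa h
    rw [Function.update_of_ne hsx0, Function.update_of_ne hsx1]
    have : sa = 2 ∧ sd = 3 ∨ sa = 3 ∧ sd = 2 := by
      have h1 : sa = 2 ∨ sa = 3 := by fin_cases sa <;> simp at hsa ⊢
      have h2 : sd = 2 ∨ sd = 3 := by fin_cases sd <;> simp at hsd ⊢
      rcases h1 with rfl | rfl <;> rcases h2 with rfl | rfl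
      · exact absurd rfl had
      · exact Or.inl ⟨rfl, rfl⟩
      · exact Or.inr ⟨rfl, rfl⟩
      · exact absurd rfl had
    rcases this with ⟨rfl, rfl⟩ | ⟨rfl, rfl⟩
    · rw [Function.update_self, Function.update_of_ne (hne 3 2 (by decide)), hd, Bool.and_false, Bool.and_false]
    · rw [Function.update_self, Function.update_of_ne (hne 2 3 (by decide)), hd, Bool.false_and, Bool.false_and]
  -- KEY: `alpha z p = z_d` on `Sol(J)`
  have hkey : ∀ z : Fin n → Bool, (∀ j ∈ J, I.eval z j = y j) → alpha I C G z (I.vars f sa) = bit (z (I.vars f sd)) := by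
    intro z hz
    have hgz := hunsat z hz
    by_cases hd : z (I.vars f sd) = true
    · -- toggle `t` and `p`
      obtain ⟨z₁, hz₁⟩ : ∃ z₁ : Fin n → Bool, z₁ = Function.update z (I.vars f sx) (!z (I.vars f sx)) := ⟨_, rfl⟩
      have hz₁p : z₁ (I.vars f sa) = z (I.vars f sa) := by rw [hz₁, Function.update_of_ne hpt]
      have hz₁d : z₁ (I.vars f sd) = true := by rw [hz₁, Function.update_of_ne hdt]; exact hd
      have hsol : ∀ j ∈ J, I.eval (Function.update z₁ (I.vars f sa) (!z₁ (I.vars f sa))) j = y j := by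
        intro j hj
        by_cases hjf : j = f
        · subst hjf
          rw [eval_update_and_slot I hI z₁ j sa sd hsa hsd had hz₁d, hz₁, eval_update_xor_slot I hI z j sx hsx, Bool.not_not]
          exact hz j hj
        · rw [eval_update_of_not_mem I j z₁ (hppriv j hj hjf), hz₁, eval_update_of_not_mem I j z (htpriv j hj hjf)]
          exact hz j hj
      have hgz' := hunsat _ hsol
      have e := bit_gval_update_and I C hnd z₁ (I.vars f sa) (!z₁ (I.vars f sa))
      rw [bit_not_add, one_mul, hz₁, bit_gval_update_xor I hT C G z hsx, if_pos htC, bit_not_add,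
        alpha_update_xor I hT C G z hsx, ← hz₁] at e
      have hvals : gval I C G (Function.update z₁ (I.vars f sa) (!z₁ (I.vars f sa))) = gval I C G z := bool_eq_of_ne hgz' hgz
      rw [hvals] at e
      have h11 := zmod2_add_self (1 : ZMod 2)
      rw [hd, show bit true = (1 : ZMod 2) from rfl]
      linear_combination -e - h11
    · -- toggle `p` only
      have hd' : z (I.vars f sd) = false := by revert hd; cases z (I.vars f sd) <;> simp
      have hsol : ∀ j ∈ J, I.eval (Function.update z (I.vars f sa) (!z (I.vars f sa))) j = y j := by
        intro j hj
        by_cases hjf : j = f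
        · subst hjf; rw [hprod0 z hd']; exact hz j hj
        · rw [eval_update_of_not_mem I j z (hppriv j hj hjf)]; exact hz j hj
      have hgz' := hunsat _ hsol
      have e := bit_gval_update_and I C hnd z (I.vars f sa) (!z (I.vars f sa))
      rw [bit_not_add, one_mul] at e
      have hvals : gval I C G (Function.update z (I.vars f sa) (!z (I.vars f sa))) = gval I C G z := bool_eq_of_ne hgz' hgz
      rw [hvals] at e
      rw [hd', show bit false = (0 : ZMod 2) from rfl]
      linear_combination -e
  -- `d ∉ N_G(p)` (the pair `{p,d}` is `f`'s, and `f ∉ G`)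
  have hdN : I.vars f sd ∉ nbG I G (I.vars f sa) := by
    intro h
    obtain ⟨g', hg', hpair, hother⟩ := mem_nbG.1 h
    have hne : g' ≠ f := fun e => disjoint_left.1 hJG hf (e ▸ hg')
    have heq : andPair I g' = andPair I f := by
      rw [← pair_eq_of_mem I (I.vars f sa) hpair, hother]
      unfold PstarGapLinearised.andPair
      have : sa = 2 ∧ sd = 3 ∨ sa = 3 ∧ sd = 2 := by
        have h1 : sa = 2 ∨ sa = 3 := by fin_cases sa <;> simp at hsa ⊢
        have h2 : sd = 2 ∨ sd = 3 := by fin_cases sd <;> simp at hsd ⊢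
        rcases h1 with rfl | rfl <;> rcases h2 with rfl | rfl
        · exact absurd rfl had
        · exact Or.inl ⟨rfl, rfl⟩
        · exact Or.inr ⟨rfl, rfl⟩
        · exact absurd rfl had
      rcases this with ⟨rfl, rfl⟩ | ⟨rfl, rfl⟩
      · rfl
      · exact pair_comm _ _
    exact (andPairs_simple I hI hS (insert f G)).2 g' (mem_insert_of_mem hg') f (mem_insert_self _ _) hne heq
  -- the AND-parity `⊕_{N_G(p) ∪ {d}} = [p ∈ C]` on `Sol(J)`
  obtain ⟨C₁, hC₁⟩ : ∃ C₁ : Finset (Fin n), C₁ = insert (I.vars f sd) (nbG I G (I.vars f sa)) := ⟨_, rfl⟩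
  have hpar : ∀ z : Fin n → Bool, (∀ j ∈ J, I.eval z j = y j) → parity C₁ z = decide (I.vars f sa ∈ C) := by
    intro z hz
    apply bit_injective
    have e := hkey z hz
    rw [alpha_eq I C hdist] at e
    rw [bit_parity, hC₁, sum_insert hdN]
    have hdec : bit (decide (I.vars f sa ∈ C)) = if I.vars f sa ∈ C then 1 else 0 := by
      by_cases h : I.vars f sa ∈ C <;> simp [h, bit]
    rw [hdec]
    have h2 := zmod2_add_self (bit (z (I.vars f sd)))
    have hP := zmod2_add_self (if I.vars f sa ∈ C then (1 : ZMod 2) else 0)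
    linear_combination e + h2 - hP
  -- so its negation is infeasible on `J`; GapOneAnd refutes that
  have hinf : ¬ Feasible I y {(C₁, !decide (I.vars f sa ∈ C))} J := by
    rintro ⟨z, hzW, hzJ⟩
    have h1 : parity C₁ z = !decide (I.vars f sa ∈ C) := hzW _ (mem_singleton_self _)
    rw [hpar z hzJ] at h1
    revert h1; cases decide (I.vars f sa ∈ C) <;> decide
  obtain ⟨J', hJ'J, hmin⟩ := exists_minInfeasible_subset (I := I) (y := y) {(C₁, !decide (I.vars f sa ∈ C))} J hinf
  have hAnd : ∀ cb ∈ ({(C₁, !decide (I.vars f sa ∈ C))} : Finset (Finset (Fin n) × Bool)), ∀ v ∈ cb.1, IsAndVar I v := by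
    intro cb hcb v hv
    rw [mem_singleton] at hcb
    subst hcb
    change v ∈ C₁ at hv
    rw [hC₁, mem_insert] at hv
    intro j s hs
    rcases hv with rfl | hv
    · exact fun h => hT j f s sd hs hsd h
    · obtain ⟨g', -, hx, -, -⟩ := mem_nbG_and hnd hv
      rcases hx with hx | hx
      · exact fun h => hT j g' s 2 hs (by decide) (h.trans hx.symm)
      · exact fun h => hT j g' s 3 hs (by decide) (h.trans hx.symm)
  have hJ'0 : J' = ∅ := gapOneAnd n m r I hI hT hB hS y {(C₁, !decide (I.vars f sa ∈ C))} J' hAnd (by simp)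
    ((card_le_card hJ'J).trans hJr) hmin
  subst hJ'0
  apply hmin.1
  -- the empty family is feasible: realise the parity alone
  by_cases hc : (!decide (I.vars f sa ∈ C)) = true
  · refine ⟨fun v => decide (v = I.vars f sd), fun e he => ?_, fun j hj => absurd hj (notMem_empty j)⟩
    rw [mem_singleton] at he; subst he
    show parity C₁ _ = _
    rw [hc]
    unfold PstarPDT.parity
    rw [decide_eq_true_eq]
    have : C₁.filter (fun v => decide (v = I.vars f sd) = true) = {I.vars f sd} := by
      ext v
      simp only [mem_filter, mem_singleton, decide_eq_true_eq, hC₁, mem_insert]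
      constructor
      · rintro ⟨-, h⟩; exact h
      · rintro rfl; exact ⟨Or.inl rfl, rfl⟩
    rw [this, card_singleton]
    exact odd_one
  · refine ⟨fun _ => false, fun e he => ?_, fun j hj => absurd hj (notMem_empty j)⟩
    rw [mem_singleton] at he; subst he
    show parity C₁ _ = _
    have hc' : (!decide (I.vars f sa ∈ C)) = false := by revert hc; cases decide (I.vars f sa ∈ C) <;> decide
    rw [hc']
    unfold PstarPDT.parity
    simp

end NoChord

end Summit.PneNP.PneNP.Theorems.PstarGSatNoChord
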